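import Literature.NumberTheory.GelbartRogawski1991.UnitaryDualPairWeilCoinvariants
import Literature.NumberTheory.Automorphic.UnitaryGroupFinAdelicCenter
import HarnessLib

-- buildfix G11b-3 recipe (LEDGER B13-1/B13-3): elaborate sequentially so the trailing `attribute [implicit_reducible]`
-- block (reducibilityCoreExt is keyed to the async environment branch) is in force at `.olean` export.
set_option Elab.async false

/-!
# The Weil coinvariants have central character `χ`: `Ω(s, χ)` is Liu's maximal quotient

Topic `NumberTheory/GelbartRogawski1991`; namespace
`Literature.NumberTheory.GelbartRogawski1991.UnitaryDualPair.WeilCoinv`.  Kernel only (0 records, 0 named facts).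

[Liu2021, App. D §D.1 Step 3 (l. 5219)] defines `ω(μ, ε, χ)` as «the maximal quotient of `ω(ε, μ) ∘ ι_μ |_{U(V)}` on
which the CENTRE of `U(V)` acts by `χ`», the centre being the norm-one torus `E¹` ([Mok2014, §1]).  The file
`UnitaryDualPairWeilCoinvariants.lean` forms instead `weilCoinv χ hs` = the maximal quotient of `𝒮((𝔸_F^∞)^{N M})` on
which the second member `U(J_W)(𝔸_{F,f})` of the dual pair acts by `χ`.  This file proves that the two agree:

* `pairSmall₁_finPairToAdelic_finAdelicCenter` — a compatible pair splitting `s` (a homomorphism on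
  `G₁(𝔸_F) = U(J_V ⊗ J_W)(𝔸_F)`) takes the SAME value at `((1, u·1_V), 1)` and `(1, (1, u·1_W))`, because
  `(1, u·1_V) ⊗ 1 = 1 ⊗ (1, u·1_W)` in `G₁(𝔸_F)` (`UnitaryGroup.adelicInl_finAdelicCenter_eq_adelicInr_finAdelicCenter`);
* `finPairRepV_finAdelicCenter` — hence `ω_f(s_pair)` restricted to the centre of `U(J_V)(𝔸_f)` IS `ω_f(s_pair)` restricted
  to the centre of `U(J_W)(𝔸_f)`: `finPairRepV hs (u·1_V) = finPairRepW hs (u·1_W)` for every norm-one finite idèle `u`;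
* **`weilCoinv_finAdelicCenter`** — the centre of `U(J_V)(𝔸_{F,f})` acts on `Ω(s, χ)` by the character
  `u ↦ χ(u·1_W)`: `Ω(s,χ)(u·1_V) x = χ(u·1_W) • x` (central character `χ`, transported along
  `E¹(𝔸_f) ≅ Z(U(J_V)) ≅ Z(U(J_W))`);
* **`ker_eq_ker_comp_finAdelicCenter`** — for `M = 1` (`J_W = (j)`, `j ≠ 0`, so `U(J_W)(𝔸_f) = E¹(𝔸_f)·1`,
  `UnitaryGroup.finAdelicCenter_surjective_one`) the relation submodule of `weilCoinv χ` EQUALS the relation submodule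
  of the centre of `U(J_V)` acting through `finPairRepV` with the character `χ(·1_W)`: `Ω(s, χ)` is LITERALLY the maximal
  quotient of `ω_f ∘ s |_{U(J_V)}` with central character `χ` — Liu's Step 3, finite-adelic part.

Not treated: the restricted tensor product `⊗'_v` presentation, non-vanishing, irreducibility (Lemma D.1).

## References
* [Liu2021] Y. Liu, *Fourier–Jacobi cycles and arithmetic relative trace formula*, Camb. J. Math. 9 (2021) =
  arXiv:2102.11518, App. D §D.1 Step 3 (l. 5219), Def. 4.11.
* [GelbartRogawski1991] S. Gelbart, J. Rogawski, Invent. Math. 105 (1991), §3.1 p. 454–457.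
* [Mok2014] C. P. Mok, Mem. AMS 235 (2015), §1 Notation p. 5.
-/

noncomputable section

namespace Literature.NumberTheory.GelbartRogawski1991.UnitaryDualPair.WeilCoinv

open Literature.NumberTheory.GelbartRogawski1991 Literature.NumberTheory.GelbartRogawski1991.UnitaryDualPair
open Literature.NumberTheory.Automorphic Literature.NumberTheory.Weil1964
open scoped Kronecker
open NumberField NumberField.mixedEmbedding IsDedekindDomain
open Literature.RepresentationTheory

/-! ### §0. A generic lemma: relation submodules along a surjection -/

section Generic

variable {k : Type*} [CommRing k] {H H' S : Type*} [Group H] [Group H'] [AddCommGroup S] [Module k S]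

/-- pulling a representation and a character back along a SURJECTIVE homomorphism does not change the relation
submodule `span {ρ h v − χ h v}` of the `χ`-coinvariants. [cite: Liu2021, App. D §D.1 Step 3 (l. 5219)] -/
theorem twistedCoinv_ker_comp_eq_of_surjective (ρW : Representation k H S) (χ : H →* kˣ) (φ : H' →* H)
    (hφ : Function.Surjective φ) : TwistedCoinv.ker (ρW.comp φ) (χ.comp φ) = TwistedCoinv.ker ρW χ := by
  unfold TwistedCoinv.ker
  congr 1
  ext w
  constructor
  · rintro ⟨⟨h', v⟩, rfl⟩
    exact ⟨(φ h', v), rfl⟩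
  · rintro ⟨⟨h, v⟩, rfl⟩
    obtain ⟨h', rfl⟩ := hφ h
    exact ⟨(h', v), rfl⟩

end Generic

section GenericFinRep

variable {F : Type} [Field F] [NumberField F] {ι : Type} [Fintype ι] [DecidableEq ι]
  {T : Matrix ι ι (AdeleRing (𝓞 F) F)} {H : Type*} [Monoid H]

/-- `ω_f(s h)` depends on `h` only through `s h`. [cite: Weil1964, Chap. III n° 37–38 p. 188–190] -/
theorem finRepMp_congr_apply (hT : IsUnit T) (σ : H →* adelicMpCont F ι T)
    (harch : ∀ (h : H) (a w : ι → mixedSpace F),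
      (adelicMpCont.proj F ι T (σ h)).1 (archVec F ι a, archVec F ι w) = (archVec F ι a, archVec F ι w))
    {h h' : H} (hh : σ h = σ h') : finRepMp hT σ harch h = finRepMp hT σ harch h' := by
  simp only [finRepMp_apply, hh]

end GenericFinRep

variable (F E : Type) [Field F] [NumberField F] [Field E] [NumberField E] [Algebra F E]
variable (c : E ≃ₐ[F] E) (N M : ℕ) {n : ℕ} (e : Fin N × Fin M ≃ Fin n)
variable (JV : Matrix (Fin N) (Fin N) E) (JW : Matrix (Fin M) (Fin M) E)
variable {TV : Matrix (Fin N) (Fin N) F} {TW : Matrix (Fin M) (Fin M) F}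
variable [Algebra.IsQuadraticExtension F E] {δ : E} (hcδ : c δ = -δ) (hδ : δ ≠ 0) {d : F}
  (hd : δ * δ = algebraMap F E d) (hV : TV.IsSymm) (hW : TW.IsSymm) (hVd : IsUnit TV.det) (hWd : IsUnit TW.det)
  (hJV : JV = TV.map (algebraMap F E)) (hJW : JW = TW.map (algebraMap F E))
  {s : UnitaryGroup.adelicPair F E c N M JV JW →* adelicMpCont F (Fin n) (adelicGram F e TV TW)}

/-! ### §1. The splitting agrees on the two centres -/

omit [Algebra.IsQuadraticExtension F E] in
/-- **`ω`-splitting at the two centres**: `(pairSmall₁ s ∘ finPairToAdelic) (u·1_V, 1) = (pairSmall₁ s ∘ finPairToAdelic) (1, u·1_W)`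
— `s` is a homomorphism on `G₁(𝔸_F)` and `(1,u·1_V) ⊗ 1 = 1 ⊗ (1,u·1_W)` there. [cite: GelbartRogawski1991, §3.1 p. 454] -/
theorem pairSmall₁_finPairToAdelic_finAdelicCenter (u : UnitaryGroup.finAdelicOne F E c) :
    (pairSmall₁ F E c N M e JV JW s).comp (finPairToAdelic F E c N M JV JW)
        (UnitaryGroup.finAdelicCenter F E c N JV u, 1) =
      (pairSmall₁ F E c N M e JV JW s).comp (finPairToAdelic F E c N M JV JW)
        (1, UnitaryGroup.finAdelicCenter F E c M JW u) := by
  have hmul : ((UnitaryGroup.finAdelicCenter F E c N JV u, UnitaryGroup.finAdelicCenter F E c M JW u⁻¹) :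
        UnitaryGroup.finAdelic F E c N JV × UnitaryGroup.finAdelic F E c M JW) *
        (1, UnitaryGroup.finAdelicCenter F E c M JW u) = (UnitaryGroup.finAdelicCenter F E c N JV u, 1) :=
    Prod.ext (by rw [Prod.fst_mul]; dsimp only; rw [mul_one])
      (by rw [Prod.snd_mul]; dsimp only; rw [← map_mul, inv_mul_cancel, map_one])
  have hone : (pairSmall₁ F E c N M e JV JW s).comp (finPairToAdelic F E c N M JV JW)
      (UnitaryGroup.finAdelicCenter F E c N JV u, UnitaryGroup.finAdelicCenter F E c M JW u⁻¹) = 1 := by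
    rw [MonoidHom.comp_apply]
    unfold pairSmall₁
    rw [MonoidHom.comp_apply]
    -- `pairSplitting s (finPairToAdelic (a, b)) = s (adelicInl a_𝔸 * adelicInr b_𝔸)` definitionally; no rewriting over
    -- the heavy carriers (cf. the implementation note of `AdelicMetaplecticSeesawSum`)
    exact (congrArg (fun x => (adelicMpContReindex F e (TV.map (algebraMap F (AdeleRing (𝓞 F) F)) ⊗ₖ
        TW.map (algebraMap F (AdeleRing (𝓞 F) F)))).symm.toMonoidHom (s x))
      (UnitaryGroup.adelicInl_finAdelicToAdelic_finAdelicCenter_mul_inv F E c N M JV JW u)).trans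
      (by simp only [map_one])
  -- no `rw` over the heavy carriers: a `calc` of `congrArg` / `map_mul` steps
  calc (pairSmall₁ F E c N M e JV JW s).comp (finPairToAdelic F E c N M JV JW) (UnitaryGroup.finAdelicCenter F E c N JV u, 1)
      = (pairSmall₁ F E c N M e JV JW s).comp (finPairToAdelic F E c N M JV JW)
          (((UnitaryGroup.finAdelicCenter F E c N JV u, UnitaryGroup.finAdelicCenter F E c M JW u⁻¹) :
            UnitaryGroup.finAdelic F E c N JV × UnitaryGroup.finAdelic F E c M JW) *
            (1, UnitaryGroup.finAdelicCenter F E c M JW u)) :=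
        congrArg (fun p => (pairSmall₁ F E c N M e JV JW s).comp (finPairToAdelic F E c N M JV JW) p) hmul.symm
    _ = (pairSmall₁ F E c N M e JV JW s).comp (finPairToAdelic F E c N M JV JW)
            (UnitaryGroup.finAdelicCenter F E c N JV u, UnitaryGroup.finAdelicCenter F E c M JW u⁻¹) *
          (pairSmall₁ F E c N M e JV JW s).comp (finPairToAdelic F E c N M JV JW)
            (1, UnitaryGroup.finAdelicCenter F E c M JW u) := map_mul _ _ _
    _ = (pairSmall₁ F E c N M e JV JW s).comp (finPairToAdelic F E c N M JV JW)
          (1, UnitaryGroup.finAdelicCenter F E c M JW u) := (congrArg (· * _) hone).trans (one_mul _)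

/-- **the two centres act identically on `𝒮`**: `finPairRepV hs (u·1_V) = finPairRepW hs (u·1_W)` for every norm-one
finite idèle `u`. [cite: GelbartRogawski1991, §3.1 p. 454; Liu2021, App. D §D.1 Step 3 (l. 5219)] -/
theorem finPairRepV_finAdelicCenter (hs : (splittingDatum F E c N M e JV JW hcδ hδ hd hV hW hVd hWd hJV hJW).IsCompatible s)
    (u : UnitaryGroup.finAdelicOne F E c) :
    finPairRepV F E c N M e JV JW hcδ hδ hd hV hW hVd hWd hJV hJW hs (UnitaryGroup.finAdelicCenter F E c N JV u) =
      finPairRepW F E c N M e JV JW hcδ hδ hd hV hW hVd hWd hJV hJW hs (UnitaryGroup.finAdelicCenter F E c M JW u) := by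
  rw [finPairRepV_apply, finPairRepW_apply]
  exact finRepMp_congr_apply _ _ _ (pairSmall₁_finPairToAdelic_finAdelicCenter F E c N M e JV JW u)

/-- as representations of the torus: `finPairRepV hs ∘ (·1_V) = finPairRepW hs ∘ (·1_W)`.
[cite: GelbartRogawski1991, §3.1 p. 454; Liu2021, App. D §D.1 Step 3 (l. 5219)] -/
theorem finPairRepV_comp_finAdelicCenter
    (hs : (splittingDatum F E c N M e JV JW hcδ hδ hd hV hW hVd hWd hJV hJW).IsCompatible s) :
    (finPairRepV F E c N M e JV JW hcδ hδ hd hV hW hVd hWd hJV hJW hs).comp (UnitaryGroup.finAdelicCenter F E c N JV) =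
      (finPairRepW F E c N M e JV JW hcδ hδ hd hV hW hVd hWd hJV hJW hs).comp (UnitaryGroup.finAdelicCenter F E c M JW) :=
  MonoidHom.ext fun u => finPairRepV_finAdelicCenter F E c N M e JV JW hcδ hδ hd hV hW hVd hWd hJV hJW hs u

/-! ### §2. Central character of `Ω(s, χ)` -/

variable (χ : UnitaryGroup.finAdelic F E c M JW →* ℂˣ)

/-- **`Ω(s, χ)` has central character `χ`**: the centre `u·1_V` of `U(J_V)(𝔸_{F,f})` acts on the `χ`-coinvariants by the
scalar `χ(u·1_W)`. [cite: Liu2021, App. D §D.1 Step 3 (l. 5219)] -/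
theorem weilCoinv_finAdelicCenter
    (hs : (splittingDatum F E c N M e JV JW hcδ hδ hd hV hW hVd hWd hJV hJW).IsCompatible s)
    (u : UnitaryGroup.finAdelicOne F E c)
    (x : TwistedCoinv.Coinv (finPairRepW F E c N M e JV JW hcδ hδ hd hV hW hVd hWd hJV hJW hs) χ) :
    weilCoinv F E c N M e JV JW hcδ hδ hd hV hW hVd hWd hJV hJW χ hs (UnitaryGroup.finAdelicCenter F E c N JV u) x =
      ((χ (UnitaryGroup.finAdelicCenter F E c M JW u) : ℂˣ) : ℂ) • x := by
  obtain ⟨f, rfl⟩ := TwistedCoinv.mk_surjective (finPairRepW F E c N M e JV JW hcδ hδ hd hV hW hVd hWd hJV hJW hs) χ x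
  rw [weilCoinv_mk, ← finPairRepV_apply, finPairRepV_finAdelicCenter, TwistedCoinv.mk_ρW]

/-- the same for the pull-back along the centre: `Ω(s,χ) ∘ (·1_V) = χ(·1_W) • id`.
[cite: Liu2021, App. D §D.1 Step 3 (l. 5219)] -/
theorem weilCoinv_comp_finAdelicCenter_apply
    (hs : (splittingDatum F E c N M e JV JW hcδ hδ hd hV hW hVd hWd hJV hJW).IsCompatible s)
    (u : UnitaryGroup.finAdelicOne F E c)
    (x : TwistedCoinv.Coinv (finPairRepW F E c N M e JV JW hcδ hδ hd hV hW hVd hWd hJV hJW hs) χ) :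
    (weilCoinv F E c N M e JV JW hcδ hδ hd hV hW hVd hWd hJV hJW χ hs).comp (UnitaryGroup.finAdelicCenter F E c N JV) u x =
      ((χ.comp (UnitaryGroup.finAdelicCenter F E c M JW) u : ℂˣ) : ℂ) • x :=
  weilCoinv_finAdelicCenter F E c N M e JV JW hcδ hδ hd hV hW hVd hWd hJV hJW χ hs u x

/-! ### §3. `M = 1`: `Ω(s, χ)` is the maximal quotient with central character `χ` -/

/-- **Liu's Step 3, finite-adelic part, for a hermitian LINE `W`** (`M = 1`, `J_W = (j)`, `j ≠ 0`): the relation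
submodule `span {ω_f(1,(1,w)) f − χ(w) f | w ∈ U(J_W)(𝔸_f)}` defining `Ω(s, χ) = weilCoinv χ hs` EQUALS the relation
submodule `span {ω_f((1,u·1_V),1) f − χ(u·1_W) f | u ∈ E¹(𝔸_f)}` of the CENTRE of `U(J_V)(𝔸_f)` acting through
`finPairRepV hs` with the character `u ↦ χ(u·1_W)` — so `Ω(s, χ)` is the maximal quotient of `ω_f ∘ s |_{U(J_V)(𝔸_f)}` on
which the centre acts by `χ`. (`U(J_W)(𝔸_f) = E¹(𝔸_f)·1_W`, `UnitaryGroup.finAdelicCenter_surjective_one`, and §1.)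
[cite: Liu2021, App. D §D.1 Step 3 (l. 5219)] -/
theorem ker_eq_ker_comp_finAdelicCenter {e₁ : Fin N × Fin 1 ≃ Fin n} {JW₁ : Matrix (Fin 1) (Fin 1) E}
    {TW₁ : Matrix (Fin 1) (Fin 1) F} (hW₁ : TW₁.IsSymm) (hW₁d : IsUnit TW₁.det) (hJW₁ : JW₁ = TW₁.map (algebraMap F E))
    {s₁ : UnitaryGroup.adelicPair F E c N 1 JV JW₁ →* adelicMpCont F (Fin n) (adelicGram F e₁ TV TW₁)}
    (hs₁ : (splittingDatum F E c N 1 e₁ JV JW₁ hcδ hδ hd hV hW₁ hVd hW₁d hJV hJW₁).IsCompatible s₁)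
    (χ₁ : UnitaryGroup.finAdelic F E c 1 JW₁ →* ℂˣ) (hj : JW₁ 0 0 ≠ 0) :
    TwistedCoinv.ker (finPairRepW F E c N 1 e₁ JV JW₁ hcδ hδ hd hV hW₁ hVd hW₁d hJV hJW₁ hs₁) χ₁ =
      TwistedCoinv.ker
        ((finPairRepV F E c N 1 e₁ JV JW₁ hcδ hδ hd hV hW₁ hVd hW₁d hJV hJW₁ hs₁).comp (UnitaryGroup.finAdelicCenter F E c N JV))
        (χ₁.comp (UnitaryGroup.finAdelicCenter F E c 1 JW₁)) := by
  rw [finPairRepV_comp_finAdelicCenter,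
    twistedCoinv_ker_comp_eq_of_surjective _ _ _ (UnitaryGroup.finAdelicCenter_surjective_one F E c JW₁ hj)]

/-! ### Build-lane note (ops-buildfix G11b-3 recipe, LEDGER B13-1, 2026-08-21)
`lean -o` (the hub build lane, never `lean`/the gate check) runs Lean 4.32's library-suggestion indexers
(`Lean.LibrarySuggestions.SymbolFrequency` / `SineQuaNon`, from their `exportEntriesFn`) over the statement of
every local theorem that is not a denied premise; on this family's statements (very large dependent binder
telescopes through the theta-kernel / dual-pair data) that fold runs for tens of minutes to hours and the build
lane kills the job (incident G11b-3, run/shared/lean/ops/buildfix/G11b-3-DOSSIER.md). `isDeniedPremise` skips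
`[implicit_reducible]` constants before any fold, and a reducibility status on a *theorem* is inert (Meta never
unfolds `thmInfo`; the kernel ignores the attribute), so the public theorems of this file are tagged
`[implicit_reducible]` purely to keep them out of that index. Only other effect: they are not offered by
`+suggestions` premise selectors. No statement or proof is changed; superseded if the operator lands a
deny-list form (`HarnessLib.PremiseIndex`). -/
set_option allowUnsafeReducibility true in
attribute [implicit_reducible]
  twistedCoinv_ker_comp_eq_of_surjective finRepMp_congr_apply
  pairSmall₁_finPairToAdelic_finAdelicCenter finPairRepV_finAdelicCenter
  finPairRepV_comp_finAdelicCenter weilCoinv_finAdelicCenter weilCoinv_comp_finAdelicCenter_apply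
  ker_eq_ker_comp_finAdelicCenter

end Literature.NumberTheory.GelbartRogawski1991.UnitaryDualPair.WeilCoinv

/- build-lane note, addendum (ops-buildfix B14-5, 2026-08-22): local theorem constants the `[implicit_reducible]` block above
cannot reach — auto-realized `*.congr_simp` lemmas, structure projections / `mk.inj` / `sizeOf_spec` — are still walked by the
`.olean` exporter's premise indexers (in-file census: FOLDED = 1, proxy 2.2e+10). A global `attribute` on a realized constant lands
on an async environment branch the exporter does not consult; this file-final, top-level `local` entry goes through the
synchronous scoped extension that `getReducibilityStatusCore` reads first and is never popped before export. It is not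
exported and changes no statement or proof. -/
set_option allowUnsafeReducibility true in
attribute [local implicit_reducible]
  Literature.NumberTheory.Weil1964.finRepMp.congr_simp
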